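import Summits.QuantumFields.QCD.Theorems.SpectralDefectExtinctionWegnerEstimateStubCoareaWegnerHolder
import Summits.QuantumFields.QCD.Theorems.SpectralDefectExtinctionWegnerEstimateHolderReduction
import Summits.QuantumFields.QCD.Theorems.SpectralDefectExtinctionWegnerEstimateSketchDefs
import Summits.QuantumFields.QCD.Theorems.SpectralDefectExtinctionWegnerEstimateStubCircleZeroCount
import Summits.QuantumFields.QCD.Theorems.SpectralDefectExtinctionWegnerEstimateStubResolventLocalSpectralSum
import Summits.QuantumFields.QCD.Theorems.SpectralDefectExtinctionWegnerEstimateStubEnvContinuous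
import Summits.QuantumFields.QCD.Theorems.SpectralDefectExtinctionWegnerEstimateStubStarRigidity

/-!
# The HÖLDER BRANCH of line `Sketch` (skeleton "ResolventCell", gen 4) for crux
`SpectralDefectExtinction.WegnerEstimate` (item stmt-QuantumFields-8966) — COMPOSITION over the envelope witness

The gen-4 skeleton reduces the crux to ONE stub over the continuous envelope `badEnv R R'` of the
interior-normalised min-functional `badStar R R'` (`Theorems/SpectralDefectExtinctionWegnerEstimateSketchDefs.lean`,
gen-4 section): `stub_envSmallBall`, a saturated Haar small-ball estimate with exponent `m > 1` (the two bookkeeping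
stubs `stub_envContinuous`, `stub_starRigidity` are LANDED).  The LINEAR Wegner estimate needs `m > 1 = k`; this
file records — unconditionally in everything except the small ball — that ANY POSITIVE exponent already gives the
HÖLDER Wegner estimate the planners declared an admissible repair target (`wegnerEstimate_imp_holder`,
`Theorems/WegnerEstimate/Negative/LoadBearing.lean`; margin `(1−α)/(4b₀)` in the route's extinction exponent):

`wegnerEstimateHolder_of_envSmallBallWeak` — from the WEAK small ball (`stub_envSmallBall` with `1 < m` replaced
by `0 < m`) alone, the Hölder crux statement `E N_ε ≤ C (1 + β^p) ε^α L⁴` with `α = m/(m+1) ∈ (0,1]`, via the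
landed `stub_envContinuous`, `stub_starRigidity`, `badEnv_le_badStar`, `stub_circleZeroCount` (p134960),
`stub_resolventLocalSpectralSum` (p135064), the Hölder 1-D route `stub_coareaWegnerHolder` (p147831) and the Hölder
reduction `wegnerEstimateHolder_of_localHaarWegnerHolder` (p147521).  This supersedes the gen-2c
`wegnerEstimateHolder_of_portSmallBallWeak` (p148097), whose functional `badPort` is identically zero (p152395).
Any exponent `m > 0` is what classical semialgebraic geometry (Łojasiewicz inequality + tube volumes) yields once
the zero set of `badStar R R'` is known to be a proper algebraic subset with null `e₀`-saturation.
-/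

noncomputable section

namespace Summit.QuantumFields.QCD.Cruxes.WegnerEstimate.ResolventCell

open MeasureTheory
open scoped Matrix BigOperators
open Literature.MathematicalPhysics.QuantumLattice Literature.MathematicalPhysics.QuantumFieldTheory
  Literature.Probability.LatticeModels
open Matrix
open scoped ComplexOrder

/-- **The Hölder Wegner estimate from a WEAK envelope small-ball estimate.**  IF for SOME radii `R' ≤ R` the
saturated small balls of the envelope `badEnv R R'` have product-Haar measure `≤ C_B δ^m` with SOME `m > 0`
(`stub_envSmallBall` with `1 < m` weakened to `0 < m`), THEN the Hölder Wegner estimate holds: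
`E N_ε ≤ C (1 + β^p) ε^α L⁴` for some `C > 0`, `p ≥ 0`, `α ∈ (0,1]` (in fact `α = m/(m+1)`).  Everything else —
continuity and rigidity of the witness, the 1-D coarea route, the resolvent–cell reduction — is landed. -/
theorem wegnerEstimateHolder_of_envSmallBallWeak
    (hsmallWeak : ∃ (R R' : ℕ) (m C_B : ℝ), R' ≤ R ∧ 0 < m ∧ 0 < C_B ∧
      ∀ (L : ℕ) [NeZero L], 2 ≤ L → ∀ (x : TorusSite 4 L) (U : GaugeConfig 4 L SU3) (e₀ : Edge 4 L) (δ : ℝ),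
        0 < δ → δ ≤ 1 →
        (Measure.pi fun _ : Edge 4 L => haarProbability SU3)
            {V : GaugeConfig 4 L SU3 | ∃ g : SU3,
              badEnv R R' (fun l => (fun e : Edge 4 L => if (∃ y ∈ box 4 R, e.1 = x + Torus.proj L y) then
                  Function.update V e₀ g e else U e) (x + Torus.proj L l.1, l.2)) < δ} ≤
          ENNReal.ofReal (C_B * δ ^ m)) :
    ∃ C p α : ℝ, 0 < C ∧ 0 ≤ p ∧ 0 < α ∧ α ≤ 1 ∧ ∀ β : ℝ, 1 ≤ β → ∀ (L : ℕ) [NeZero L], 2 ≤ L →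
      ∀ m₀ ε : ℝ, -1 ≤ m₀ → m₀ ≤ 0 → 0 < ε → ε ≤ 1 →
        ∫ U, (Multiset.countP (fun z : ℂ => |z.re| < ε) (spinorLift gammaFive * wilsonDirac (fundamentalRep (Fin 3)) U m₀ 1).charpoly.roots : ℝ) ∂(wilsonMeasure (d := 4) (L := L) (fundamentalRep (Fin 3)) β) ≤ C * (1 + β ^ p) * ε ^ α * (L : ℝ) ^ 4 := by
  refine wegnerEstimateHolder_of_localHaarWegnerHolder
    (stub_coareaWegnerHolder stub_circleZeroCount stub_resolventLocalSpectralSum ?_)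
  -- the weak rigidity data, derived as `stub_currentRigidity` in the gen-4 skeleton (`k = c₀ = 1`, `bad := badEnv R R'`)
  obtain ⟨R, R', m, C_B, hR', hm, hCB, hsb⟩ := hsmallWeak
  refine ⟨R, R', 1, m, 1, C_B, hR', hm, one_pos, hCB, badEnv R R', (stub_envContinuous R R').1,
    (stub_envContinuous R R').2, hsb, ?_⟩
  intro L _ hL x m₀ hm0 hm0' U V ψ lam hlam hψ
  have h := stub_starRigidity R R' hR' L hL x m₀ hm0 hm0' U V ψ lam hlam hψ
  refine le_trans ?_ h
  rw [one_mul, pow_one]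
  exact mul_le_mul_of_nonneg_right (badEnv_le_badStar R R' _) (boxMass_nonneg _ _)

end Summit.QuantumFields.QCD.Cruxes.WegnerEstimate.ResolventCell

end
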